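import Literature.AlgebraicGeometry.Resolution.RidgeCone
import Literature.AlgebraicGeometry.Resolution.WeightedCentreHasseDirectrixBridge
import Literature.AlgebraicGeometry.Resolution.HasseSchmidtDiffEqDiffOp
import HarnessLib

/-!
# The ridge of a hypersurface cone is its Hasse–Schmidt stabiliser (Giraud; Berthomieu–Hivert–Mourtada Prop. 2.1,
# principal case) — every characteristic, every commutative base algebra

Topic: `Literature/AlgebraicGeometry/Resolution`. Companion of `Ridge.lean` / `RidgeRepresentable.lean` /
`RidgeCone.lean` (Giraud's ridge functor `F(k') = {v | L_v(C ×_K k') ⊆ C ×_K k'}` of the cone `C = V(I)`,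
representability `F = V(𝔉)`, cone property) and of `WeightedCentreHasseSubspace.lean` (directional Hasse–Schmidt
derivatives `D_v^{(j)} H` = coefficients of `H(x + Tv)`), for a PRINCIPAL homogeneous ideal `I = (F)`:

> **BHM 2010, proof of Prop.–Def. 2.1** (the ideal `J` generated by the `s_ℓ(f)` — the coefficients of `f(X + v)`
> expanded along a basis of `S/I` — cuts out `F`); for `I = (F)` principal and homogeneous the expansion of
> `F(X + Tv) = Σ_j T^j D_v^{(j)} F(X)` shows directly: `v ∈ F(k') ⟺ F(X + Tv) = F(X) ⟺ D_v^{(j)} F = 0 (j ≥ 1)`.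
> **Giraud 1975, §1.5**: "`F(k') = {v ∈ V(k') | L_v(C ×_k k') ⊂ C ×_k k'}` … Ce foncteur est représentable par un
> sous-schéma en groupes fermé de `V`, qui est aussi un cône."

PROVED here (`ridge_span_singleton_iff_forall_hasseD`, `ridge_span_singleton_iff_dirShift_eq_C`): for a form `F` of
degree `b` over a field `K` and every commutative `K`-algebra `k'` in the universe of `K`, a vector `v ∈ (k')ⁿ` is a
`k'`-point of the ridge of the cone `F = 0` iff every positive-order directional Hasse–Schmidt derivative of `F ⊗ 1`
along `v` vanishes, iff `F(X + Tv) = F(X)` formally in `T`. (⇒ uses that the ridge is a functorial cone — tree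
`map_mem_ridge`, `smul_mem_ridge'` — so `T · v` is a `k'[T]`-point; transporting `F(X + Tv) ∈ (F) · k'[T][X]` to
`k'[X][T]` along Mathlib's `optionEquivRight.symm ≫ optionEquivLeft`, each `T^j`-coefficient `D_v^{(j)} F` is a multiple
of `F` of lower degree, hence `0`. ⇐: set `T = 1`.) Also `isHomogeneous_hasseDeriv_of_isHomogeneous` /
`isHomogeneous_hasseD` (Hasse derivatives of forms are forms, EGA IV₄ 16.11.2 binomial formula).

First landed summit-side (cell res-hironaka, `Summit.…Theorems.CampaignW46.TameRidgeFunctor`, p485759); ported here so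
that the Literature named fact `PrincipalRidgeIdealEqSpanHasse` (`PointBlowupRidge.lean`) can be discharged in
`PrincipalRidgeHasseCoefficients.lean`. AI-written; AI review is weaker than expert review.

## References

* J. Berthomieu, P. Hivert, H. Mourtada, *Computing Hironaka's invariants: ridge and directrix*, Contemp. Math. 521
  (2010), Prop.–Def. 2.1 and its proof. [BerthomieuHivertMourtada2010]
* J. Giraud, *Contact maximal en caractéristique positive*, Ann. Sci. ÉNS 8 (1975), §1.5. [Giraud1975]
* A. Grothendieck, EGA IV₄, Thm. 16.11.2 (Hasse–Schmidt binomial formula). [EGAIV4]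
* H. Hironaka, *Additive groups associated with points of a projective space*, Ann. of Math. 92 (1970), §1. [Hironaka1970AdditiveGroups]
-/

noncomputable section

open MvPolynomial
open Literature.RingTheory.MvPolynomial
open Literature.AlgebraicGeometry.Resolution.WeightedBlowup.HasseDir

namespace Literature.AlgebraicGeometry.Resolution

universe u v

/-! ## Hasse–Schmidt derivatives of forms are forms -/

section Homogeneous

variable {σ : Type*} {R : Type*} [CommRing R]

/-- **Hasse–Schmidt derivatives of a form are forms**: `D^{(α)} f` is homogeneous of degree `d − |α|` for `f`
homogeneous of degree `d` (binomial formula on monomials; derived here).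
[cite: EGAIV4, Thm. 16.11.2 (16.11.2.1)] -/
theorem isHomogeneous_hasseDeriv_of_isHomogeneous [DecidableEq σ] {f : MvPolynomial σ R} {d : ℕ}
    (hf : f.IsHomogeneous d) (α : σ →₀ ℕ) : (hasseDeriv R α f).IsHomogeneous (d - α.degree) := by
  rw [f.as_sum, map_sum]
  refine IsHomogeneous.sum _ _ _ fun δ hδ => ?_
  by_cases hle : α ≤ δ
  · rw [hasseDeriv_monomial]
    have hdeg : (δ - α).degree = d - α.degree := by
      have h1 : (δ - α).degree + α.degree = δ.degree := by rw [← map_add, tsub_add_cancel_of_le hle]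
      have h2 : δ.degree = d := by
        by_contra h
        exact (mem_support_iff.mp hδ) (hf.coeff_eq_zero h)
      omega
    rw [← map_natCast C, C_mul_monomial]
    exact isHomogeneous_monomial _ hdeg
  · rw [hasseDeriv_monomial_eq_zero_of_not_le R hle]
    exact isHomogeneous_zero _ _ _

/-- **Directional Hasse–Schmidt derivatives of a form are forms**: `D_v^{(j)} H` is homogeneous of degree `d − j`
(`D_v^{(j)} = Σ_{|α|=j} v^α D^{(α)}`; derived here). [cite: EGAIV4, Thm. 16.11.2]
[cite: Hironaka1970AdditiveGroups, §1] -/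
theorem isHomogeneous_hasseD_of_isHomogeneous {H : MvPolynomial σ R} {d : ℕ} (hH : H.IsHomogeneous d) (v : σ → R)
    (j : ℕ) : (hasseD v j H).IsHomogeneous (d - j) := by
  classical
  rw [hasseD_eq_sum_hasseDeriv]
  refine IsHomogeneous.sum _ _ _ fun α hα => ?_
  rw [Finset.mem_filter] at hα
  have h := (isHomogeneous_C σ (α.prod fun i e => v i ^ e)).mul (isHomogeneous_hasseDeriv_of_isHomogeneous hH α)
  rwa [hα.2, zero_add] at h

/-- A multiple of a form of degree `b` has no coefficients in degree `< b`. [folklore] -/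
private theorem coeff_mul_eq_zero_of_lt {S : Type*} [CommSemiring S] {G : MvPolynomial σ S} {b : ℕ}
    (hG : G.IsHomogeneous b) (g : MvPolynomial σ S) {m : σ →₀ ℕ} (hm : m.degree < b) : coeff m (g * G) = 0 := by
  classical
  rw [coeff_mul]
  refine Finset.sum_eq_zero fun x hx => ?_
  rw [Finset.mem_antidiagonal] at hx
  have hdeg : x.2.degree ≤ m.degree := by
    rw [← hx, map_add]
    exact Nat.le_add_left _ _
  rw [hG.coeff_eq_zero (by omega), mul_zero]

/-- A form of degree `e < b` that is a multiple of a form of degree `b` is zero. [folklore] -/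
private theorem eq_zero_of_lt_of_mem_span {S : Type*} [CommSemiring S] {G H : MvPolynomial σ S} {b e : ℕ}
    (hG : G.IsHomogeneous b) (hH : H.IsHomogeneous e) (he : e < b)
    (h : H ∈ Ideal.span ({G} : Set (MvPolynomial σ S))) : H = 0 := by
  obtain ⟨g, hg⟩ := Ideal.mem_span_singleton'.mp h
  ext m
  rw [coeff_zero]
  by_cases hm : m.degree = e
  · rw [← hg]
    exact coeff_mul_eq_zero_of_lt hG g (by omega)
  · exact hH.coeff_eq_zero hm

end Homogeneous

/-! ## Shifts along a line and the directional shift -/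

section Hasse

variable {σ : Type*} {R : Type*} [CommRing R]

/-- `G(X + c v)` is the value at `T = c` of `G(X + Tv)`. [folklore] -/
private theorem eval_C_dirShift (v : σ → R) (c : R) (G : MvPolynomial σ R) :
    Polynomial.eval (C c) (dirShift v G) = shift (c • v) G := by
  have key : ((Polynomial.aeval (R := MvPolynomial σ R) (C c : MvPolynomial σ R)).restrictScalars R).comp
      (dirShift v) = shift (c • v) := by
    refine MvPolynomial.algHom_ext fun i => ?_
    simp only [AlgHom.comp_apply, AlgHom.restrictScalars_apply, dirShift_X, Polynomial.coe_aeval_eq_eval,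
      Polynomial.eval_add, Polynomial.eval_C, Polynomial.eval_mul, Polynomial.eval_X, shift_X, Pi.smul_apply,
      smul_eq_mul, C_mul]
    ring
  have h := congrArg (fun φ : MvPolynomial σ R →ₐ[R] MvPolynomial σ R => φ G) key
  simpa only [AlgHom.comp_apply, AlgHom.restrictScalars_apply, Polynomial.coe_aeval_eq_eval] using h

/-- All positive-order Hasse derivatives along `v` vanish iff `G(X + Tv) = G(X)` formally. [folklore] -/
private theorem dirShift_eq_C_iff (v : σ → R) (G : MvPolynomial σ R) :
    dirShift v G = Polynomial.C G ↔ ∀ j : ℕ, 1 ≤ j → hasseD v j G = 0 := by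
  constructor
  · intro h j hj
    rw [hasseD_def, h, Polynomial.coeff_C, if_neg (by omega)]
  · intro h
    refine Polynomial.ext fun j => ?_
    rw [Polynomial.coeff_C]
    split_ifs with hj
    · rw [hj, ← hasseD_def, hasseD_zero]
    · rw [← hasseD_def]
      exact h j (Nat.one_le_iff_ne_zero.mpr hj)

end Hasse

/-! ## Points of the ridge of a hypersurface cone -/

section Ridge

variable {K : Type u} [Field K] {n : ℕ}

/-- `(F) · k'[X] = (F ⊗ 1)`. [folklore] -/
private theorem coneIdeal_span_singleton (k' : Type v) [CommRing k'] [Algebra K k'] (F : MvPolynomial (Fin n) K) :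
    coneIdeal k' (Ideal.span {F}) = Ideal.span {MvPolynomial.map (algebraMap K k') F} := by
  rw [coneIdeal, Ideal.map_span, Set.image_singleton]

/-- `v ∈ F(k')` iff `F(X + v) ∈ (F) · k'[X]`. [folklore] -/
private theorem mem_ridge_span_singleton_iff_shift_mem {k' : Type v} [CommRing k'] [Algebra K k']
    (F : MvPolynomial (Fin n) K) (v : Fin n → k') :
    v ∈ ridge k' (Ideal.span {F}) ↔
      shift v (MvPolynomial.map (algebraMap K k') F) ∈
        Ideal.span ({MvPolynomial.map (algebraMap K k') F} : Set (MvPolynomial (Fin n) k')) := by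
  rw [mem_ridge_iff_forall_mem, coneIdeal_span_singleton]
  constructor
  · intro h
    exact h F (Ideal.mem_span_singleton_self F)
  · intro h f hf
    obtain ⟨g, rfl⟩ := Ideal.mem_span_singleton'.mp hf
    rw [map_mul, map_mul]
    exact Ideal.mul_mem_left _ _ h

/-- If `F(X + v) = F(X)` then `v ∈ F(k')`. [folklore] -/
private theorem mem_ridge_of_shift_eq {k' : Type v} [CommRing k'] [Algebra K k'] (F : MvPolynomial (Fin n) K)
    {v : Fin n → k'} (h : shift v (MvPolynomial.map (algebraMap K k') F) = MvPolynomial.map (algebraMap K k') F) :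
    v ∈ ridge k' (Ideal.span {F}) := by
  rw [mem_ridge_span_singleton_iff_shift_mem, h]
  exact Ideal.mem_span_singleton_self _

/-- A principal ideal generated by a form is homogeneous. [folklore] -/
private theorem homogeneousComponent_mem_span_singleton {F : MvPolynomial (Fin n) K} {b : ℕ}
    (hF : F.IsHomogeneous b) :
    ∀ f ∈ Ideal.span ({F} : Set (MvPolynomial (Fin n) K)), ∀ d : ℕ,
      homogeneousComponent d f ∈ Ideal.span ({F} : Set (MvPolynomial (Fin n) K)) := by
  intro f hf d
  obtain ⟨g, rfl⟩ := Ideal.mem_span_singleton'.mp hf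
  have hg : g * F = ∑ i ∈ Finset.range (g.totalDegree + 1), homogeneousComponent i g * F := by
    rw [← Finset.sum_mul, sum_homogeneousComponent]
  rw [hg, map_sum]
  refine Ideal.sum_mem _ fun i _ => ?_
  have hmem : homogeneousComponent i g * F ∈ homogeneousSubmodule (Fin n) K (i + b) :=
    (mem_homogeneousSubmodule _ _).mpr ((homogeneousComponent_isHomogeneous i g).mul hF)
  rw [homogeneousComponent_of_mem hmem]
  split_ifs
  · exact Ideal.mul_mem_left _ _ (Ideal.mem_span_singleton_self F)
  · exact Ideal.zero_mem _

/-! ## Transport `k'[T][X] ≅ k'[X][T]` -/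

section Transport

variable {k' : Type v} [CommRing k'] [Algebra K k']

/-- The composite `optionEquivRight.symm ≫ optionEquivLeft : k'[T][X_1..X_n] ≅ k'[X][T]` on a variable `X_i`.
[folklore] -/
private theorem optionEquiv_X (i : Fin n) :
    ((optionEquivRight k' (Fin n)).symm.trans (optionEquivLeft k' (Fin n))) (X i : MvPolynomial (Fin n) (Polynomial k')) =
      Polynomial.C (X i) := by
  have h1 : (optionEquivRight k' (Fin n)).symm (X i : MvPolynomial (Fin n) (Polynomial k')) = X (some i) :=
    (AlgEquiv.symm_apply_eq _).mpr (optionEquivRight_X_some (R := k') (Fin n) i).symm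
  rw [AlgEquiv.trans_apply, h1, optionEquivLeft_X_some]

/-- … on a constant `C (C a)`. [folklore] -/
private theorem optionEquiv_C_C (a : k') :
    ((optionEquivRight k' (Fin n)).symm.trans (optionEquivLeft k' (Fin n)))
        (C (Polynomial.C a) : MvPolynomial (Fin n) (Polynomial k')) = Polynomial.C (C a) := by
  have h1 : (optionEquivRight k' (Fin n)).symm (C (Polynomial.C a) : MvPolynomial (Fin n) (Polynomial k')) = C a :=
    (AlgEquiv.symm_apply_eq _).mpr (optionEquivRight_C k' (Fin n) a).symm
  rw [AlgEquiv.trans_apply, h1, optionEquivLeft_C]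

/-- … on the constant `C T`. [folklore] -/
private theorem optionEquiv_C_X :
    ((optionEquivRight k' (Fin n)).symm.trans (optionEquivLeft k' (Fin n)))
        (C Polynomial.X : MvPolynomial (Fin n) (Polynomial k')) = Polynomial.X := by
  have h1 : (optionEquivRight k' (Fin n)).symm (C Polynomial.X : MvPolynomial (Fin n) (Polynomial k')) = X none :=
    (AlgEquiv.symm_apply_eq _).mpr (optionEquivRight_X_none k' (Fin n)).symm
  rw [AlgEquiv.trans_apply, h1, optionEquivLeft_X_none]

/-- Under `optionEquivRight.symm ≫ optionEquivLeft`, the base change `F ⊗ 1` of `F` to `k'[T]` is the constant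
polynomial `C (F ⊗ 1)`. [folklore] -/
private theorem optionEquiv_map (F : MvPolynomial (Fin n) K) :
    ((optionEquivRight k' (Fin n)).symm.trans (optionEquivLeft k' (Fin n)))
        (MvPolynomial.map (algebraMap K (Polynomial k')) F) =
      Polynomial.C (MvPolynomial.map (algebraMap K k') F) := by
  induction F using MvPolynomial.induction_on with
  | C a => rw [map_C, map_C, Polynomial.algebraMap_apply, optionEquiv_C_C]
  | add p q hp hq => rw [map_add, map_add, hp, hq, map_add, map_add]
  | mul_X p i hp => rw [map_mul, map_X, map_mul, hp, optionEquiv_X, map_mul, map_X, ← map_mul]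

/-- Under the same equivalence, the translate of `F ⊗ 1` by `T · v` is the directional shift `F(X + Tv)`.
[folklore] -/
private theorem optionEquiv_shift_map (F : MvPolynomial (Fin n) K) (v : Fin n → k') :
    ((optionEquivRight k' (Fin n)).symm.trans (optionEquivLeft k' (Fin n)))
        (shift ((Polynomial.X : Polynomial k') • fun j => Polynomial.C (v j))
          (MvPolynomial.map (algebraMap K (Polynomial k')) F)) =
      dirShift v (MvPolynomial.map (algebraMap K k') F) := by
  induction F using MvPolynomial.induction_on with
  | C a =>
    have h2 : shift ((Polynomial.X : Polynomial k') • fun j => Polynomial.C (v j))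
        (C (Polynomial.C (algebraMap K k' a)) : MvPolynomial (Fin n) (Polynomial k')) =
          C (Polynomial.C (algebraMap K k' a)) := by
      simp [shift]
    rw [map_C, map_C, Polynomial.algebraMap_apply, h2, optionEquiv_C_C, dirShift_C]
  | add p q hp hq => rw [map_add, map_add, map_add, hp, hq, map_add, map_add]
  | mul_X p i hp =>
    have h4 : shift ((Polynomial.X : Polynomial k') • fun j => Polynomial.C (v j))
        (X i : MvPolynomial (Fin n) (Polynomial k')) = X i + C Polynomial.X * C (Polynomial.C (v i)) := by
      rw [shift_X, Pi.smul_apply, smul_eq_mul, map_mul]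
    rw [map_mul, map_X, map_mul, map_mul, hp, h4, map_add, optionEquiv_X, map_mul, optionEquiv_C_X, optionEquiv_C_C,
      map_mul, map_X, map_mul, dirShift_X]
    ring

end Transport

/-! ## The ridge of a form is its Hasse stabiliser (every characteristic) -/

section Main

/-- Points of the ridge kill all positive-order directional Hasse derivatives of the form. [folklore] -/
private theorem hasseD_eq_zero_of_mem_ridge {k' : Type u} [CommRing k'] [Algebra K k'] {F : MvPolynomial (Fin n) K} {b : ℕ}
    (hF : F.IsHomogeneous b) {v : Fin n → k'} (hv : v ∈ ridge k' (Ideal.span {F})) :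
    ∀ j : ℕ, 1 ≤ j → hasseD v j (MvPolynomial.map (algebraMap K k') F) = 0 := by
  intro j hj
  set F' := MvPolynomial.map (algebraMap K k') F with hF'
  rcases Nat.lt_or_ge b j with hlt | hle
  · exact hasseD_eq_zero_of_totalDegree_lt v F' ((hF.map _).totalDegree_le.trans_lt hlt)
  · -- the `k'[T]`-point `T · (v ⊗ 1)` of the ridge
    have hw : (fun j => Polynomial.C (v j)) ∈ ridge (Polynomial k') (Ideal.span {F}) :=
      map_mem_ridge (IsScalarTower.toAlgHom K k' (Polynomial k')) hv
    have hXw := smul_mem_ridge' (homogeneousComponent_mem_span_singleton hF) (Polynomial.X : Polynomial k') hw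
    have hmem := (mem_ridge_span_singleton_iff_shift_mem F _).mp hXw
    obtain ⟨g, hg⟩ := Ideal.mem_span_singleton'.mp hmem
    -- transport to `k'[X][T]`
    have hΨ := congrArg ((optionEquivRight k' (Fin n)).symm.trans (optionEquivLeft k' (Fin n))) hg
    rw [map_mul, optionEquiv_map, optionEquiv_shift_map] at hΨ
    -- compare `T^j`-coefficients: `D_v^{(j)} F'` is a multiple of `F'`
    have hcoeff := congrArg (fun q => Polynomial.coeff q j) hΨ
    simp only [Polynomial.coeff_mul_C] at hcoeff
    rw [← hasseD_def] at hcoeff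
    have hmemj : hasseD v j F' ∈ Ideal.span ({F'} : Set (MvPolynomial (Fin n) k')) :=
      Ideal.mem_span_singleton'.mpr ⟨_, hcoeff⟩
    exact eq_zero_of_lt_of_mem_span (hF.map _) (isHomogeneous_hasseD_of_isHomogeneous (hF.map _) v j)
      (by omega) hmemj

/-- Vanishing of all positive-order Hasse derivatives along `v` puts `v` in the ridge. [folklore] -/
private theorem mem_ridge_of_forall_hasseD {k' : Type v} [CommRing k'] [Algebra K k'] (F : MvPolynomial (Fin n) K)
    {v : Fin n → k'} (h : ∀ j : ℕ, 1 ≤ j → hasseD v j (MvPolynomial.map (algebraMap K k') F) = 0) :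
    v ∈ ridge k' (Ideal.span {F}) := by
  refine mem_ridge_of_shift_eq F ?_
  have hC := (dirShift_eq_C_iff v _).mpr h
  have h1 := eval_C_dirShift v (1 : k') (MvPolynomial.map (algebraMap K k') F)
  rw [hC, Polynomial.eval_C, one_smul] at h1
  exact h1.symm

/-- **The ridge of a hypersurface cone is its Hasse–Schmidt stabiliser.** For a form `F` of degree `b` over a field
`K` and every commutative `K`-algebra `k'` (in the universe of `K`): `v ∈ F(k')` — Giraud's functor, "`L_v(C ×_K k') ⊆
C ×_K k'`" — iff every positive-order directional Hasse–Schmidt derivative of `F ⊗ 1` along `v` vanishes (BHM: the ridge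
is cut out by the coefficients of `f(X + v)`; here for `I = (F)` principal). Every characteristic.
[cite: BerthomieuHivertMourtada2010, Prop.–Def. 2.1 (proof)] [cite: Giraud1975, §1.5] -/
theorem ridge_span_singleton_iff_forall_hasseD {k' : Type u} [CommRing k'] [Algebra K k']
    {F : MvPolynomial (Fin n) K} {b : ℕ} (hF : F.IsHomogeneous b) (v : Fin n → k') :
    v ∈ ridge k' (Ideal.span {F}) ↔ ∀ j : ℕ, 1 ≤ j → hasseD v j (MvPolynomial.map (algebraMap K k') F) = 0 :=
  ⟨hasseD_eq_zero_of_mem_ridge hF, mem_ridge_of_forall_hasseD F⟩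

/-- Equivalently: `v ∈ F(k')` iff `F(X + Tv) = F(X)` formally in `T` (Hironaka's translations leaving a form invariant,
read over an arbitrary commutative base). [cite: Giraud1975, §1.5] [cite: Hironaka1970AdditiveGroups, §1–2] -/
theorem ridge_span_singleton_iff_dirShift_eq_C {k' : Type u} [CommRing k'] [Algebra K k']
    {F : MvPolynomial (Fin n) K} {b : ℕ} (hF : F.IsHomogeneous b) (v : Fin n → k') :
    v ∈ ridge k' (Ideal.span {F}) ↔
      dirShift v (MvPolynomial.map (algebraMap K k') F) = Polynomial.C (MvPolynomial.map (algebraMap K k') F) := by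
  rw [ridge_span_singleton_iff_forall_hasseD hF, dirShift_eq_C_iff]

end Main

end Ridge

end Literature.AlgebraicGeometry.Resolution

end
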